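import Literature.AlgebraicGeometry.GroupSchemes.BarsottiTateGroupHom
import HarnessLib

/-!
# Isomorphisms of Barsotti–Tate groups; the socket `IsOfAbelianScheme` determines `A[p^∞]` up to a unique isomorphism

Topic `Literature/AlgebraicGeometry/GroupSchemes`; namespace `Literature.AlgebraicGeometry.GroupSchemes.BTGroup`.  Cell
`hodgecm-mathlib` (D-0151), FLOOR 0, P6 «MOD programme» generic organ (n5); sibling of ★ `BarsottiTateGroup` (carrier + socket
`IsOfAbelianScheme`), ★ `BarsottiTateGroupHom` (`BTGroup.Hom`, `existsUnique_hom_of_kernelPresentation`), ★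
`AbelianSchemes/PDivisibleGroupOfAbelianScheme` (the construction `pDivisibleGroup`).  `--supports stmt-HodgeConjecture-24832`; COUNT-NEUTRAL:
HC_CM is proved only modulo the 7 printed citations until rung 0 closes; this file discharges none of them.  One `structure`
(`BTGroup.Iso`) + plumbing `def`s (`Iso.app ∕ refl ∕ symm ∕ trans`) + theorems; no named fact, no instance, no notation, no `sorry`.

THE PRINT.  [Tate1967] §2 (2.1)–(2.2): the category of `p`-divisible groups; `A ↦ A(p)` a functor.  This file closes the loop
opened by the review of p844278 («the socket must CHARACTERISE `B = A[p^∞]`»): any two Barsotti–Tate groups satisfying the socket for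
the same abelian scheme are isomorphic, canonically.

WHAT IS HERE: §1 **`BTGroup.Iso B B'`** (pair of inverse `Hom`s), `Iso.app n : B.G n ≅ B'.G n`, `refl ∕ symm ∕ trans`,
**`Iso.height_eq`** (over a non-empty base and `p ≥ 2`, isomorphic BT groups have equal heights — ranks of the first layers); §2
**`exists_iso_of_kernelPresentation`** (two kernel presentations in the same `S`-group scheme `M` are isomorphic compatibly with the
presentations; ★ `existsUnique_hom_of_kernelPresentation` at `𝟙 M` both ways), `hom_ext_of_kernelPresentation` (uniqueness), and
**`IsOfAbelianScheme.nonempty_iso : B.IsOfAbelianScheme A → B'.IsOfAbelianScheme A → Nonempty (Iso B B')`**.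

## References
* [Tate1967] J. T. Tate, *p-divisible groups*, Proc. Conf. Local Fields (Driebergen 1966), Springer 1967 — §2 (2.1)–(2.2).
-/

noncomputable section

universe u

open CategoryTheory CategoryTheory.Limits AlgebraicGeometry MonoidalCategory CartesianMonoidalCategory
open scoped MonObj

namespace Literature.AlgebraicGeometry.GroupSchemes

namespace BTGroup

variable {S : Scheme.{u}} {p h h' : ℕ}

/-! ## §1 Isomorphisms -/

/-- **An ISOMORPHISM of Barsotti–Tate groups**: a pair of inverse homomorphisms (heights may differ a priori; over a non-empty base
they then agree, by the ranks). [cite: Tate1967, §2 (2.1)] -/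
structure Iso (B : BTGroup S p h) (B' : BTGroup S p h') where
  /-- the homomorphism `B → B'` -/
  hom : Hom B B'
  /-- its inverse `B' → B` -/
  inv : Hom B' B
  /-- `hom ≫ inv = 𝟙` -/
  hom_inv_id : hom.comp inv = Hom.id B
  /-- `inv ≫ hom = 𝟙` -/
  inv_hom_id : inv.comp hom = Hom.id B'

namespace Iso

variable {B : BTGroup S p h} {B' : BTGroup S p h'}

/-- Layerwise, an isomorphism of Barsotti–Tate groups is an isomorphism of `S`-schemes `B.G n ≅ B'.G n`. [cite: Tate1967, §2 (2.1)] -/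
def app (e : Iso B B') (n : ℕ) : B.G n ≅ B'.G n where
  hom := e.hom.app n
  inv := e.inv.app n
  hom_inv_id := by rw [← Hom.comp_app, e.hom_inv_id, Hom.id_app]
  inv_hom_id := by rw [← Hom.comp_app, e.inv_hom_id, Hom.id_app]

/-- Unfolding. [cite: Tate1967, §2 (2.1)] -/
@[simp] theorem app_hom (e : Iso B B') (n : ℕ) : (e.app n).hom = e.hom.app n := rfl

/-- Unfolding. [cite: Tate1967, §2 (2.1)] -/
@[simp] theorem app_inv (e : Iso B B') (n : ℕ) : (e.app n).inv = e.inv.app n := rfl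

variable (B) in
/-- The identity isomorphism. [cite: Tate1967, §2 (2.1)] -/
def refl : Iso B B := ⟨Hom.id B, Hom.id B, Hom.id_comp _, Hom.id_comp _⟩

/-- The inverse isomorphism. [cite: Tate1967, §2 (2.1)] -/
def symm (e : Iso B B') : Iso B' B := ⟨e.inv, e.hom, e.inv_hom_id, e.hom_inv_id⟩

/-- Composition of isomorphisms. [cite: Tate1967, §2 (2.1)] -/
def trans {h'' : ℕ} {B'' : BTGroup S p h''} (e : Iso B B') (f : Iso B' B'') : Iso B B'' where
  hom := e.hom.comp f.hom
  inv := f.inv.comp e.inv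
  hom_inv_id := by rw [Hom.comp_assoc, ← Hom.comp_assoc f.hom, f.hom_inv_id, Hom.id_comp, e.hom_inv_id]
  inv_hom_id := by rw [Hom.comp_assoc, ← Hom.comp_assoc e.inv, e.inv_hom_id, Hom.id_comp, f.inv_hom_id]

/-- Over a non-empty base, isomorphic Barsotti–Tate groups for `p ≥ 2` have the same height (compare the ranks `p ^ (1 · h)` of the
first layers at a point). [cite: Tate1967, §2 (2.1)] -/
theorem height_eq (e : Iso B B') (hp : 2 ≤ p) (s : S) : h = h' := by
  haveI := B.isFinite 1; haveI := B.flat 1; haveI := B'.isFinite 1; haveI := B'.flat 1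
  have h1 := B.finrank_eq 1 s
  have h2 := B'.finrank_eq 1 s
  -- the rank of `B.G 1 → S` at `s` is that of `B'.G 1 → S`, through the isomorphism of `S`-schemes `(e.app 1).left`
  haveI : IsIso (e.hom.app 1).left := (inferInstance : IsIso ((Over.forget S).mapIso (e.app 1)).hom)
  have h3 : (B.G 1).hom = (e.hom.app 1).left ≫ (B'.G 1).hom := (Over.w (e.hom.app 1)).symm
  have h4 := Scheme.Hom.finrank_comp_left_of_isIso (e.hom.app 1).left (B'.G 1).hom
  rw [h3, h4] at h1
  have h12 : p ^ (1 * h) = p ^ (1 * h') := h1.symm.trans h2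
  rw [one_mul, one_mul] at h12
  exact Nat.pow_right_injective hp h12

end Iso

/-! ## §2 A kernel presentation determines the Barsotti–Tate group up to a unique isomorphism -/

section KernelPresentation

variable {M : Over S} [GrpObj M] {B : BTGroup S p h} {B' : BTGroup S p h'}

/-- **UNIQUENESS OF `A[p^∞]` UP TO ISOMORPHISM**: two Barsotti–Tate groups presented as the kernels of `[p^n]` in the SAME `S`-group
scheme `M` (the data of the socket `IsOfAbelianScheme`: homomorphisms `i n : B.G n ⟶ M`, `i' n : B'.G n ⟶ M` with cartesian squares
against the unit section, compatibly with the transitions) are ISOMORPHIC, by the unique isomorphism commuting with the presentations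
(★ `existsUnique_hom_of_kernelPresentation` at `f = 𝟙 M`, both ways). [cite: Tate1967, §2 (2.1)] -/
theorem exists_iso_of_kernelPresentation
    (i : ∀ n, B.G n ⟶ M) (hi : ∀ n, letI := B.grpObj n; IsMonHom (i n))
    (hsq : ∀ n, IsPullback (i n) (toUnit (B.G n)) (((𝟙 M : M ⟶ M) ^ (p ^ n) : M ⟶ M)) η[M])
    (hcomp : ∀ n, B.incl n ≫ i (n + 1) = i n)
    (i' : ∀ n, B'.G n ⟶ M) (hi' : ∀ n, letI := B'.grpObj n; IsMonHom (i' n))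
    (hsq' : ∀ n, IsPullback (i' n) (toUnit (B'.G n)) (((𝟙 M : M ⟶ M) ^ (p ^ n) : M ⟶ M)) η[M])
    (hcomp' : ∀ n, B'.incl n ≫ i' (n + 1) = i' n) :
    ∃ e : Iso B B', ∀ n, e.hom.app n ≫ i' n = i n := by
  obtain ⟨F, hF, -⟩ := existsUnique_hom_of_kernelPresentation i hi hsq hcomp i' hi' hsq' hcomp' (𝟙 M)
  obtain ⟨G, hG, -⟩ := existsUnique_hom_of_kernelPresentation i' hi' hsq' hcomp' i hi hsq hcomp (𝟙 M)
  haveI : ∀ n, Mono (i n) := fun n => mono_of_isPullback_unit (hsq n)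
  haveI : ∀ n, Mono (i' n) := fun n => mono_of_isPullback_unit (hsq' n)
  refine ⟨⟨F, G, Hom.ext fun n => ?_, Hom.ext fun n => ?_⟩, fun n => (hF n).trans (Category.comp_id _)⟩
  · rw [Hom.comp_app, Hom.id_app, ← cancel_mono (i n), Category.assoc, hG n, Category.comp_id, hF n, Category.comp_id,
      Category.id_comp]
  · rw [Hom.comp_app, Hom.id_app, ← cancel_mono (i' n), Category.assoc, hF n, Category.comp_id, hG n, Category.comp_id,
      Category.id_comp]

/-- The isomorphism of the previous theorem is UNIQUE among homomorphisms commuting with the presentations. [cite: Tate1967, §2 (2.1)] -/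
theorem hom_ext_of_kernelPresentation (i : ∀ n, B.G n ⟶ M) (i' : ∀ n, B'.G n ⟶ M)
    (hsq' : ∀ n, IsPullback (i' n) (toUnit (B'.G n)) (((𝟙 M : M ⟶ M) ^ (p ^ n) : M ⟶ M)) η[M])
    {F G : Hom B B'} (hF : ∀ n, F.app n ≫ i' n = i n) (hG : ∀ n, G.app n ≫ i' n = i n) : F = G := by
  haveI : ∀ n, Mono (i' n) := fun n => mono_of_isPullback_unit (hsq' n)
  exact Hom.ext fun n => by rw [← cancel_mono (i' n), hF n, hG n]

end KernelPresentation

/-- **THE SOCKET CHARACTERISES `A[p^∞]`**: two Barsotti–Tate groups satisfying `IsOfAbelianScheme A` are isomorphic (and of the same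
height over a non-empty base for `p ≥ 2`, `Iso.height_eq`). [cite: Tate1967, §2 (2.1)] -/
theorem IsOfAbelianScheme.nonempty_iso {A : AbelianSchemes.AbelianSchemeOver S} {B : BTGroup S p h} {B' : BTGroup S p h'}
    (hB : B.IsOfAbelianScheme A) (hB' : B'.IsOfAbelianScheme A) : Nonempty (Iso B B') := by
  obtain ⟨i, hi, hsq, hcomp⟩ := hB
  obtain ⟨i', hi', hsq', hcomp'⟩ := hB'
  obtain ⟨e, -⟩ := exists_iso_of_kernelPresentation i hi hsq hcomp i' hi' hsq' hcomp'
  exact ⟨e⟩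

end BTGroup

end Literature.AlgebraicGeometry.GroupSchemes

end
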